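import Summits.CriticalPhenomena.CardyFormulaZ2.Theorems.CardyBoundaryCoulombGasRectilinearCardyClosureDefs
import Summits.CriticalPhenomena.CardyFormulaZ2.Theorems.CardyBoundaryCoulombGasRectilinearCardyStubFlatMarksReduction
import Summits.CriticalPhenomena.CardyFormulaZ2.Theorems.RectilinearCardy.Negative.RectilinearCardyReductions
import Literature.Probability.RandomPlanarGeometry.ConformalRectangleProofs
import HarnessLib

/-!
# Stub `stub_closureFlatMarksReduction` of line `excursion-kernel-covariance`
# (crux `RectilinearCardy`, stmt-CriticalPhenomena-5660, route `CardyBoundaryCoulombGas`)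

The flat-marks reduction in the CLOSURE discretisation (closure twin of the landed mesh theorem
`stub_flatMarksReduction`): Cardy's formula for the closure crossing probability
`closureCrossingProb R δ = P_{1/2}[rowArc R δ ↔ rowTail R δ (mark 2) in V_δ]` of all rectilinear
conformal rectangles whose four marked points are FLAT boundary points implies it for all rectilinear
conformal rectangles `R = (Ω; a, b, c, d)`.

Proof (port of the mesh proof). Let `(φ, g, S₀, S)` be the boundary correspondence of `R` (first
hypothesis). Then `x i = g (mark i)` is a uniformizing datum of `R`, so by datum-independence of the
cross-ratio it suffices to show `P^cl_δ(R) → F(η(x))`.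
* The closure crossing probability, read on the boundary row of `V_δ`, is the `P_{1/2}`-probability of
  an open path of `V_δ` between the row vertices attributed (closest-arc rule) to `∂Ω[mark 0, mark 1]`
  and those attributed to `∂Ω[mark 2, mark 3]` (`cfm_closureCrossingProb_eq_row`); the attribution is
  monotone in the arc (`cfm_rowAttr_mono`, the row analogue of `discreteArc_mono`), hence so is the
  probability (`cfm_rowProb_mono`).
* Non-flat parameters of `[S₀, S]` are finite (`exists_finset_flatNear`, mesh file).
* For flat parameters `m₀ < m₁ < m₂ < m₃` in `[S₀, S₀ + 1)` the re-parametrised, re-marked rectangle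
  `R♯ = (Ω; ∂Ω(m₀), …, ∂Ω(m₃))` has the SAME carrier, hence the same `V_δ` and boundary row, and its
  `rowArc`/`rowTail (mark 2)` are the row vertices attributed to `∂Ω[m₀, m₁]`/`∂Ω[m₂, m₃]`; it is
  rectilinear with flat marks and `(φ, (g mᵢ)ᵢ)` is a uniformizing datum of it, so the second
  hypothesis gives the limit `F(η((g mᵢ)ᵢ))` for the row probability between `∂Ω[m₀, m₁]` and
  `∂Ω[m₂, m₃]` (`cfm_tendsto_rowProb_of_flatParams`).
* Shrinking both arcs of `R` to flat end-parameters gives a lower bound, enlarging them an upper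
  bound, for every mesh `δ`; and `m ↦ F(η((g mᵢ)ᵢ))` is continuous at `m = mark`
  (`exists_forall_dist_cardyFunction_lt`, mesh file), whence the squeeze.
-/

noncomputable section

open Set Filter Topology MeasureTheory
open Literature.Probability.RandomPlanarGeometry
open Literature.Probability.Percolation (bondDomainCrossingProb discreteCrossingProb half bondPercolation openCrossing openConnIn)
open Literature.Probability.LatticeModels (Site meshPoint meshDomain meshBoundary discreteArc
  meshDomain_finite meshVertices meshVertices_finite zdGraph)
open Summit.CriticalPhenomena.CardyFormulaZ2.Theorems.RectilinearCardy.Negative (IsRectilinear)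
open UpperHalfPlane (upperHalfPlaneSet)

namespace Summit.CriticalPhenomena.CardyFormulaZ2.Cruxes.RectilinearCardy.ExcursionKernelCovariance

/-! ### Monotonicity of the row crossing probability in the two arcs -/

/-- Open crossing events are monotone in the source and target sets. [folklore] -/
theorem cfm_openCrossing_mono {V : Type*} (S : Set V) {A A' B B' : Set V} (hA : A ⊆ A')
    (hB : B ⊆ B') : openCrossing S A B ⊆ openCrossing S A' B' := by
  rintro ω ⟨x, hx, y, hy, hω⟩
  exact ⟨x, hA hx, y, hB hy, hω⟩

/-- **The closest-arc attribution of boundary-row vertices is monotone in the arc** (row analogue of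
`discreteArc_mono`): as long as the smaller arc is nonempty and the larger one does not exhaust the
frontier. [folklore] -/
theorem cfm_rowAttr_mono (R : ConformalRectangle) (δ : ℝ) {A A' : Set ℂ} (hAA' : A ⊆ A')
    (hA : A.Nonempty) (hc : (frontier R.carrier \ A').Nonempty) :
    {v : Site 2 | v ∈ boundaryRow R δ ∧
        Metric.infDist (meshPoint δ v) A ≤ Metric.infDist (meshPoint δ v) (frontier R.carrier \ A)} ⊆
      {v : Site 2 | v ∈ boundaryRow R δ ∧
        Metric.infDist (meshPoint δ v) A' ≤ Metric.infDist (meshPoint δ v) (frontier R.carrier \ A')} := by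
  rintro v ⟨hv, h⟩
  refine ⟨hv, ?_⟩
  calc Metric.infDist (meshPoint δ v) A'
      ≤ Metric.infDist (meshPoint δ v) A := Metric.infDist_le_infDist_of_subset hAA' hA
    _ ≤ Metric.infDist (meshPoint δ v) (frontier R.carrier \ A) := h
    _ ≤ Metric.infDist (meshPoint δ v) (frontier R.carrier \ A') :=
        Metric.infDist_le_infDist_of_subset (fun z hz => ⟨hz.1, fun h' => hz.2 (hAA' h')⟩) hc

/-- **The row crossing probability is monotone in both arcs**: enlarging the arcs `A ⊆ A'`, `B ⊆ B'`
(nonempty, the larger ones not exhausting the frontier) enlarges both attributed row sets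
(`cfm_rowAttr_mono`), hence the crossing event in `V_δ`, hence its probability. [folklore] -/
theorem cfm_rowProb_mono (R : ConformalRectangle) (δ : ℝ) {A A' B B' : Set ℂ} (hA : A ⊆ A')
    (hAn : A.Nonempty) (hA' : (frontier R.carrier \ A').Nonempty) (hB : B ⊆ B') (hBn : B.Nonempty)
    (hB' : (frontier R.carrier \ B').Nonempty) :
    (bondPercolation (zdGraph 2) half).real
        (openCrossing (↑(closureFinset R δ) : Set (Site 2))
          {v | v ∈ boundaryRow R δ ∧
            Metric.infDist (meshPoint δ v) A ≤ Metric.infDist (meshPoint δ v) (frontier R.carrier \ A)}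
          {v | v ∈ boundaryRow R δ ∧
            Metric.infDist (meshPoint δ v) B ≤ Metric.infDist (meshPoint δ v) (frontier R.carrier \ B)}) ≤
      (bondPercolation (zdGraph 2) half).real
        (openCrossing (↑(closureFinset R δ) : Set (Site 2))
          {v | v ∈ boundaryRow R δ ∧
            Metric.infDist (meshPoint δ v) A' ≤ Metric.infDist (meshPoint δ v) (frontier R.carrier \ A')}
          {v | v ∈ boundaryRow R δ ∧
            Metric.infDist (meshPoint δ v) B' ≤
              Metric.infDist (meshPoint δ v) (frontier R.carrier \ B')}) :=
  measureReal_mono (cfm_openCrossing_mono _ (cfm_rowAttr_mono R δ hA hAn hA')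
    (cfm_rowAttr_mono R δ hB hBn hB')) (measure_ne_top _ _)

/-- **The closure crossing probability read on the boundary row**: it is the probability of an open
path of `V_δ` between the row vertices attributed to `∂Ω[mark 0, mark 1] = R.arc 0` and those
attributed to `∂Ω[mark 2, mark 3] = tailArc R (mark 2)`. [folklore] -/
theorem cfm_closureCrossingProb_eq_row (R : ConformalRectangle) (δ : ℝ) :
    closureCrossingProb R δ = (bondPercolation (zdGraph 2) half).real
      (openCrossing (↑(closureFinset R δ) : Set (Site 2))
        {v | v ∈ boundaryRow R δ ∧
          Metric.infDist (meshPoint δ v) (R.boundary '' Icc (R.mark 0) (R.mark 1)) ≤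
            Metric.infDist (meshPoint δ v) (frontier R.carrier \ R.boundary '' Icc (R.mark 0) (R.mark 1))}
        {v | v ∈ boundaryRow R δ ∧
          Metric.infDist (meshPoint δ v) (R.boundary '' Icc (R.mark 2) (R.mark 3)) ≤
            Metric.infDist (meshPoint δ v)
              (frontier R.carrier \ R.boundary '' Icc (R.mark 2) (R.mark 3))}) := by
  have harc0 : R.arc 0 = R.boundary '' Icc (R.mark 0) (R.mark 1) := by
    show R.boundary '' Icc (R.mark 0) (R.nextMark 0) = _
    rw [R.nextMark_zero]
  rw [closureCrossingProb_eq]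
  congr 2
  · ext v
    rw [Finset.mem_coe, mem_rowArc_iff, harc0, mem_setOf_eq]
  · ext v
    rw [Finset.mem_coe, mem_rowTail_iff, mem_setOf_eq]
    rfl

/-! ### Cardy's formula for the re-marked rectangle with flat marks (closure version) -/

/-- **Cardy's formula for the re-marked rectangle, closure discretisation.** Assume Cardy's formula
(closure version) for all rectilinear conformal rectangles with flat marks. Let `R` be rectilinear,
`m₀ < m₁ < m₂ < m₃` parameters in a period `[S₀, S₀ + 1)` at which the boundary is flat, and `(φ, x)`
a conformal equivalence `ℍₒ → Ω` with boundary value `∂Ω(mᵢ)` at the (monotone or antitone) real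
points `xᵢ`. Then the probability of an open path of `V_δ` between the boundary-row vertices
attributed to `∂Ω[m₀, m₁]` and those attributed to `∂Ω[m₂, m₃]` tends to `F(η(x))`: it is the closure
crossing probability of the RE-MARKED rectangle `R♯ = (Ω; ∂Ω(m₀), …, ∂Ω(m₃))` (same carrier — hence
same `V_δ` and boundary row —, boundary loop re-based at `S₀`, marks `mᵢ - S₀ ∈ [0, 1)`), which is
rectilinear with flat marks and has `(φ, x)` as a uniformizing datum. [folklore] -/
theorem cfm_tendsto_rowProb_of_flatParams
    (hflat : ∀ R : ConformalRectangle, IsRectilinear R →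
      (∀ i : Fin 4, ∃ r : ℝ, 0 < r ∧ FlatNear R (R.pt i) r) →
        R.HasCrossingLimit (closureCrossingProb R) cardyFunction)
    (R : ConformalRectangle) (hR : IsRectilinear R) {S₀ : ℝ} {m : Fin 4 → ℝ} (hm : StrictMono m)
    (h0 : S₀ ≤ m 0) (h3 : m 3 < S₀ + 1) (hmf : ∀ i, ∃ r : ℝ, 0 < r ∧ FlatNear R (R.boundary (m i)) r)
    (φ : ConformalEquiv upperHalfPlaneSet R.carrier) {x : Fin 4 → ℝ} (hx : StrictMono x ∨ StrictAnti x)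
    (hbv : ∀ i, φ.HasBoundaryValue (x i) (R.boundary (m i))) :
    Tendsto (fun δ => (bondPercolation (zdGraph 2) half).real
      (openCrossing (↑(closureFinset R δ) : Set (Site 2))
        {v | v ∈ boundaryRow R δ ∧
          Metric.infDist (meshPoint δ v) (R.boundary '' Icc (m 0) (m 1)) ≤
            Metric.infDist (meshPoint δ v) (frontier R.carrier \ R.boundary '' Icc (m 0) (m 1))}
        {v | v ∈ boundaryRow R δ ∧
          Metric.infDist (meshPoint δ v) (R.boundary '' Icc (m 2) (m 3)) ≤
            Metric.infDist (meshPoint δ v) (frontier R.carrier \ R.boundary '' Icc (m 2) (m 3))}))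
      (𝓝[>] 0) (𝓝 (cardyFunction (crossRatio x))) := by
  have hle3 : ∀ i : Fin 4, i ≤ 3 := by decide
  -- the re-parametrised, re-marked rectangle `R♯` (same carrier)
  let R' : ConformalRectangle :=
    { carrier := R.carrier
      boundary := fun u => R.boundary (u + S₀)
      isOpen := R.isOpen
      isBounded := R.isBounded
      isConnected := R.isConnected
      continuous_boundary := R.continuous_boundary.comp (continuous_id.add continuous_const)
      periodic_boundary := R.periodic_boundary.add_const _
      injOn_boundary := fun s hs t ht hst => add_right_cancel (R.toJordanDomain.injOn_boundary_Ico S₀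
        (show s + S₀ ∈ Ico S₀ (S₀ + 1) from ⟨by linarith [hs.1], by linarith [hs.2]⟩)
        (show t + S₀ ∈ Ico S₀ (S₀ + 1) from ⟨by linarith [ht.1], by linarith [ht.2]⟩) hst)
      range_boundary := by
        rw [show (fun u => R.boundary (u + S₀)) = R.boundary ∘ fun u => u + S₀ from rfl,
          (add_right_surjective _).range_comp]
        exact R.range_boundary
      mark := fun i => m i - S₀
      strictMono_mark := fun i j hij => sub_lt_sub_right (hm hij) _
      mark_mem := fun i => ⟨sub_nonneg.2 (h0.trans (hm.monotone (Fin.zero_le i))),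
        by linarith [hm.monotone (hle3 i)]⟩ }
  -- its marked points and arcs, read on `R`
  have hpt : ∀ i, R'.pt i = R.boundary (m i) := fun i => by
    show R.boundary (m i - S₀ + S₀) = R.boundary (m i)
    rw [sub_add_cancel]
  have him : ∀ a b : ℝ, R'.boundary '' Icc (a - S₀) (b - S₀) = R.boundary '' Icc a b := fun a b => by
    show (fun u => R.boundary (u + S₀)) '' Icc (a - S₀) (b - S₀) = _
    rw [show (fun u => R.boundary (u + S₀)) = R.boundary ∘ fun u => u + S₀ from rfl, image_comp,
      image_add_const_Icc, sub_add_cancel, sub_add_cancel]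
  have h0' : R'.arc 0 = R.boundary '' Icc (m 0) (m 1) := by
    show R'.boundary '' Icc (R'.mark 0) (R'.nextMark 0) = _
    rw [R'.nextMark_zero]
    exact him _ _
  have h2' : tailArc R' (R'.mark 2) = R.boundary '' Icc (m 2) (m 3) := by
    show R'.boundary '' Icc (R'.mark 2) (R'.mark 3) = _
    exact him _ _
  -- same carrier, hence same `V_δ` and boundary row; the attributed rows read on `R`
  have heq : closureCrossingProb R' = fun δ => (bondPercolation (zdGraph 2) half).real
      (openCrossing (↑(closureFinset R δ) : Set (Site 2))
        {v | v ∈ boundaryRow R δ ∧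
          Metric.infDist (meshPoint δ v) (R.boundary '' Icc (m 0) (m 1)) ≤
            Metric.infDist (meshPoint δ v) (frontier R.carrier \ R.boundary '' Icc (m 0) (m 1))}
        {v | v ∈ boundaryRow R δ ∧
          Metric.infDist (meshPoint δ v) (R.boundary '' Icc (m 2) (m 3)) ≤
            Metric.infDist (meshPoint δ v) (frontier R.carrier \ R.boundary '' Icc (m 2) (m 3))}) := by
    funext δ
    have hV : closureFinset R' δ = closureFinset R δ := rfl
    rw [closureCrossingProb_eq, hV]
    congr 2
    · ext v
      rw [Finset.mem_coe, mem_rowArc_iff, h0', mem_setOf_eq]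
      exact Iff.rfl
    · ext v
      rw [Finset.mem_coe, mem_rowTail_iff, h2', mem_setOf_eq]
      exact Iff.rfl
  -- `R♯` is rectilinear with flat marks, and `(φ, x)` is a uniformizing datum of it
  have hR' : IsRectilinear R' := hR
  have hflat' : ∀ i : Fin 4, ∃ r : ℝ, 0 < r ∧ FlatNear R' (R'.pt i) r := fun i => by
    obtain ⟨r, hr, hf⟩ := hmf i
    exact ⟨r, hr, by rw [hpt]; exact hf⟩
  have hU' : R'.IsUniformizing φ x := ⟨hx, fun i => by rw [hpt]; exact hbv i⟩
  have hlim := hflat R' hR' hflat' φ x hU'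
  rwa [heq] at hlim

/-! ### The stub -/

/-- **Stub E of line excursion-kernel-covariance (crux RectilinearCardy, stmt-CriticalPhenomena-5660)**
(registered signature, verbatim): the CLOSURE flat-marks reduction. Cardy's formula in the closure
discretisation for all rectilinear conformal rectangles with FLAT marked points (second hypothesis)
implies it for all rectilinear conformal rectangles, given the boundary correspondence of every
conformal rectangle (first hypothesis). Proof: the datum `x = g ∘ mark` computes the modulus
(`crossRatio_eq_of_isUniformizing_holds`); non-flat parameters are finite (`exists_finset_flatNear`);
moving each mark to a nearby flat parameter inwards (resp. outwards) shrinks (resp. enlarges) both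
arcs, which decreases (resp. increases) the row crossing probability at every mesh
(`cfm_rowProb_mono`, `cfm_closureCrossingProb_eq_row`); the perturbed rectangles are re-marked copies
of `R` with flat marks, whose closure crossing probabilities converge to `F(η(g ∘ m))` by hypothesis
(`cfm_tendsto_rowProb_of_flatParams`); and `F(η(g ∘ m)) → F(η(x))` as `m → mark`
(`exists_forall_dist_cardyFunction_lt`), whence the squeeze. [folklore] -/
theorem stub_closureFlatMarksReduction :
    (∀ R : ConformalRectangle,
      ∃ (φ : ConformalEquiv upperHalfPlaneSet R.carrier) (g : ℝ → ℝ) (S₀ S : ℝ) (w₀ : ℂ → ℂ),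
        S₀ < 0 ∧ R.mark 3 < S ∧ S < 1 ∧ S < S₀ + 1 ∧
        ContinuousOn g (Icc S₀ S) ∧ (StrictMonoOn g (Icc S₀ S) ∨ StrictAntiOn g (Icc S₀ S)) ∧
        (∀ t ∈ Icc S₀ S, φ.HasBoundaryValue (g t) (R.boundary t)) ∧
        EqOn w₀ φ.symm R.carrier ∧ ContinuousOn w₀ (R.carrier ∪ R.boundary '' Icc S₀ S) ∧
        ∀ t ∈ Icc S₀ S, w₀ (R.boundary t) = g t) →
    (∀ R : ConformalRectangle, IsRectilinear R → (∀ i : Fin 4, ∃ r : ℝ, 0 < r ∧ FlatNear R (R.pt i) r) →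
      R.HasCrossingLimit (closureCrossingProb R) cardyFunction) →
    ∀ R : ConformalRectangle, IsRectilinear R →
      R.HasCrossingLimit (closureCrossingProb R) cardyFunction := by
  intro hBC hflat R hR φ' x' hU'
  obtain ⟨φ, g, S₀, S, w₀, hS₀, h3S, -, hSS₀, hgc, hgm, hbv, -, -, -⟩ := hBC R
  -- bookkeeping on the marks
  have hle3 : ∀ i : Fin 4, i ≤ 3 := by decide
  have h01 : R.mark 0 < R.mark 1 := R.strictMono_mark (by decide)
  have h12 : R.mark 1 < R.mark 2 := R.strictMono_mark (by decide)
  have h23 : R.mark 2 < R.mark 3 := R.strictMono_mark (by decide)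
  have hm0 : 0 ≤ R.mark 0 := (R.mark_mem 0).1
  have hmI : ∀ i, R.mark i ∈ Icc S₀ S := fun i =>
    ⟨hS₀.le.trans (R.mark_mem i).1, (R.strictMono_mark.monotone (hle3 i)).trans h3S.le⟩
  -- (1) the datum `x = g ∘ mark` computes the modulus
  have hx : StrictMono (fun i => g (R.mark i)) ∨ StrictAnti (fun i => g (R.mark i)) :=
    strictMono_or_strictAnti_comp hgm R.strictMono_mark hmI
  have hU : R.IsUniformizing φ (fun i => g (R.mark i)) := ⟨hx, fun i => hbv _ (hmI i)⟩
  rw [ConformalRectangle.crossRatio_eq_of_isUniformizing_holds hU' hU]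
  -- (2) flat parameters are co-finite on `[S₀, S]`
  obtain ⟨T, hT⟩ := exists_finset_flatNear R hR hSS₀
  rw [Metric.tendsto_nhds]
  intro ε hε
  -- (6a) continuity of the predicted limit in the marks: the size `η`, and a common size `c`
  obtain ⟨η, hη, hcont⟩ := exists_forall_dist_cardyFunction_lt hgc hmI hx (half_pos hε)
  set c : ℝ := min η (min (R.mark 0 - S₀) (min (S - R.mark 3) (min ((R.mark 1 - R.mark 0) / 2)
    (min ((R.mark 2 - R.mark 1) / 2) ((R.mark 3 - R.mark 2) / 2))))) with hc_def
  have hc : 0 < c := lt_min hη (lt_min (by linarith) (lt_min (by linarith) (lt_min (by linarith)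
    (lt_min (by linarith) (by linarith)))))
  have hcη : c ≤ η := min_le_left _ _
  have hcA : c ≤ min (R.mark 0 - S₀) (min (S - R.mark 3) (min ((R.mark 1 - R.mark 0) / 2)
      (min ((R.mark 2 - R.mark 1) / 2) ((R.mark 3 - R.mark 2) / 2)))) := min_le_right _ _
  have hc0 : c ≤ R.mark 0 - S₀ := hcA.trans (min_le_left _ _)
  have hcB := hcA.trans (min_le_right _ _)
  have hc3 : c ≤ S - R.mark 3 := hcB.trans (min_le_left _ _)
  have hcC := hcB.trans (min_le_right _ _)
  have hc01 : c ≤ (R.mark 1 - R.mark 0) / 2 := hcC.trans (min_le_left _ _)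
  have hcD := hcC.trans (min_le_right _ _)
  have hc12 : c ≤ (R.mark 2 - R.mark 1) / 2 := hcD.trans (min_le_left _ _)
  have hc23 : c ≤ (R.mark 3 - R.mark 2) / 2 := hcD.trans (min_le_right _ _)
  -- (2') flat parameters within `c` of the marks: `u` inwards (arcs shrunk), `v` outwards (enlarged)
  obtain ⟨u, hu⟩ := exists_quadruple_notMem T
    (a := ![R.mark 0, R.mark 1 - c, R.mark 2, R.mark 3 - c])
    (b := ![R.mark 0 + c, R.mark 1, R.mark 2 + c, R.mark 3]) fun i => by
      fin_cases i
      · show R.mark 0 < R.mark 0 + c; linarith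
      · show R.mark 1 - c < R.mark 1; linarith
      · show R.mark 2 < R.mark 2 + c; linarith
      · show R.mark 3 - c < R.mark 3; linarith
  obtain ⟨v, hv⟩ := exists_quadruple_notMem T
    (a := ![R.mark 0 - c, R.mark 1, R.mark 2 - c, R.mark 3])
    (b := ![R.mark 0, R.mark 1 + c, R.mark 2, R.mark 3 + c]) fun i => by
      fin_cases i
      · show R.mark 0 - c < R.mark 0; linarith
      · show R.mark 1 < R.mark 1 + c; linarith
      · show R.mark 2 - c < R.mark 2; linarith
      · show R.mark 3 < R.mark 3 + c; linarith
  have hu0 : R.mark 0 < u 0 ∧ u 0 < R.mark 0 + c := (hu 0).1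
  have hu1 : R.mark 1 - c < u 1 ∧ u 1 < R.mark 1 := (hu 1).1
  have hu2 : R.mark 2 < u 2 ∧ u 2 < R.mark 2 + c := (hu 2).1
  have hu3 : R.mark 3 - c < u 3 ∧ u 3 < R.mark 3 := (hu 3).1
  have hv0 : R.mark 0 - c < v 0 ∧ v 0 < R.mark 0 := (hv 0).1
  have hv1 : R.mark 1 < v 1 ∧ v 1 < R.mark 1 + c := (hv 1).1
  have hv2 : R.mark 2 - c < v 2 ∧ v 2 < R.mark 2 := (hv 2).1
  have hv3 : R.mark 3 < v 3 ∧ v 3 < R.mark 3 + c := (hv 3).1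
  have huM : StrictMono u := Fin.strictMono_iff_lt_succ.2 fun k => by
    fin_cases k
    · show u 0 < u 1; linarith
    · show u 1 < u 2; linarith
    · show u 2 < u 3; linarith
  have hvM : StrictMono v := Fin.strictMono_iff_lt_succ.2 fun k => by
    fin_cases k
    · show v 0 < v 1; linarith
    · show v 1 < v 2; linarith
    · show v 2 < v 3; linarith
  have huI : ∀ i, u i ∈ Icc S₀ S := fun i => by
    fin_cases i
    · show u 0 ∈ Icc S₀ S; exact ⟨by linarith, by linarith⟩
    · show u 1 ∈ Icc S₀ S; exact ⟨by linarith, by linarith⟩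
    · show u 2 ∈ Icc S₀ S; exact ⟨by linarith, by linarith⟩
    · show u 3 ∈ Icc S₀ S; exact ⟨by linarith, by linarith⟩
  have hvI : ∀ i, v i ∈ Icc S₀ S := fun i => by
    fin_cases i
    · show v 0 ∈ Icc S₀ S; exact ⟨by linarith, by linarith⟩
    · show v 1 ∈ Icc S₀ S; exact ⟨by linarith, by linarith⟩
    · show v 2 ∈ Icc S₀ S; exact ⟨by linarith, by linarith⟩
    · show v 3 ∈ Icc S₀ S; exact ⟨by linarith, by linarith⟩
  have hud : ∀ i, dist (u i) (R.mark i) < η := fun i => by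
    rw [Real.dist_eq, abs_sub_lt_iff]
    fin_cases i
    · show u 0 - R.mark 0 < η ∧ R.mark 0 - u 0 < η; constructor <;> linarith
    · show u 1 - R.mark 1 < η ∧ R.mark 1 - u 1 < η; constructor <;> linarith
    · show u 2 - R.mark 2 < η ∧ R.mark 2 - u 2 < η; constructor <;> linarith
    · show u 3 - R.mark 3 < η ∧ R.mark 3 - u 3 < η; constructor <;> linarith
  have hvd : ∀ i, dist (v i) (R.mark i) < η := fun i => by
    rw [Real.dist_eq, abs_sub_lt_iff]
    fin_cases i
    · show v 0 - R.mark 0 < η ∧ R.mark 0 - v 0 < η; constructor <;> linarith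
    · show v 1 - R.mark 1 < η ∧ R.mark 1 - v 1 < η; constructor <;> linarith
    · show v 2 - R.mark 2 < η ∧ R.mark 2 - v 2 < η; constructor <;> linarith
    · show v 3 - R.mark 3 < η ∧ R.mark 3 - v 3 < η; constructor <;> linarith
  -- (3)+(5) closure Cardy for the re-marked flat rectangles `R_in = R♯(u)`, `R_out = R♯(v)`
  have hlim_in := cfm_tendsto_rowProb_of_flatParams hflat R hR huM (huI 0).1
    (by linarith [(huI 3).2]) (fun i => hT _ (huI i) (hu i).2) φ
    (strictMono_or_strictAnti_comp hgm huM huI) fun i => hbv _ (huI i)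
  have hlim_out := cfm_tendsto_rowProb_of_flatParams hflat R hR hvM (hvI 0).1
    (by linarith [(hvI 3).2]) (fun i => hT _ (hvI i) (hv i).2) φ
    (strictMono_or_strictAnti_comp hgm hvM hvI) fun i => hbv _ (hvI i)
  -- (6b) their limits are within `ε / 2` of the predicted limit of `R`
  have hdu := hcont u huI hud
  have hdv := hcont v hvI hvd
  -- (4) monotonicity: `P(R_in) ≤ P(R) ≤ P(R_out)` at every mesh, on the boundary row of `V_δ`
  have hfr : ∀ t, R.boundary t ∈ frontier R.carrier := R.boundary_mem_frontier
  have hmono_in : ∀ δ, (bondPercolation (zdGraph 2) half).real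
      (openCrossing (↑(closureFinset R δ) : Set (Site 2))
        {w | w ∈ boundaryRow R δ ∧
          Metric.infDist (meshPoint δ w) (R.boundary '' Icc (u 0) (u 1)) ≤
            Metric.infDist (meshPoint δ w) (frontier R.carrier \ R.boundary '' Icc (u 0) (u 1))}
        {w | w ∈ boundaryRow R δ ∧
          Metric.infDist (meshPoint δ w) (R.boundary '' Icc (u 2) (u 3)) ≤
            Metric.infDist (meshPoint δ w) (frontier R.carrier \ R.boundary '' Icc (u 2) (u 3))}) ≤
      closureCrossingProb R δ := fun δ => by
    rw [cfm_closureCrossingProb_eq_row]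
    exact cfm_rowProb_mono R δ (image_mono (Icc_subset_Icc hu0.1.le hu1.2.le))
      ((nonempty_Icc.2 (by linarith)).image _)
      ⟨R.boundary (R.mark 2), hfr _, boundary_notMem_image_Icc R hSS₀ (hmI 0).1 (hmI 1).2 (hmI 2)
        fun h => by linarith [h.2]⟩
      (image_mono (Icc_subset_Icc hu2.1.le hu3.2.le)) ((nonempty_Icc.2 (by linarith)).image _)
      ⟨R.boundary (R.mark 0), hfr _, boundary_notMem_image_Icc R hSS₀ (hmI 2).1 (hmI 3).2 (hmI 0)
        fun h => by linarith [h.1]⟩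
  have hmono_out : ∀ δ, closureCrossingProb R δ ≤ (bondPercolation (zdGraph 2) half).real
      (openCrossing (↑(closureFinset R δ) : Set (Site 2))
        {w | w ∈ boundaryRow R δ ∧
          Metric.infDist (meshPoint δ w) (R.boundary '' Icc (v 0) (v 1)) ≤
            Metric.infDist (meshPoint δ w) (frontier R.carrier \ R.boundary '' Icc (v 0) (v 1))}
        {w | w ∈ boundaryRow R δ ∧
          Metric.infDist (meshPoint δ w) (R.boundary '' Icc (v 2) (v 3)) ≤
            Metric.infDist (meshPoint δ w)
              (frontier R.carrier \ R.boundary '' Icc (v 2) (v 3))}) := fun δ => by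
    rw [cfm_closureCrossingProb_eq_row]
    exact cfm_rowProb_mono R δ (image_mono (Icc_subset_Icc hv0.2.le hv1.1.le))
      ((nonempty_Icc.2 h01.le).image _)
      ⟨R.boundary (R.mark 2), hfr _, boundary_notMem_image_Icc R hSS₀ (hvI 0).1 (hvI 1).2 (hmI 2)
        fun h => by linarith [h.2]⟩
      (image_mono (Icc_subset_Icc hv2.2.le hv3.1.le)) ((nonempty_Icc.2 h23.le).image _)
      ⟨R.boundary (R.mark 0), hfr _, boundary_notMem_image_Icc R hSS₀ (hvI 2).1 (hvI 3).2 (hmI 0)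
        fun h => by linarith [h.1]⟩
  -- (6c) the squeeze
  filter_upwards [Metric.tendsto_nhds.1 hlim_in (ε / 2) (half_pos hε),
    Metric.tendsto_nhds.1 hlim_out (ε / 2) (half_pos hε)] with δ h1 h2
  rw [Real.dist_eq, abs_sub_lt_iff] at h1 h2 hdu hdv ⊢
  constructor <;> linarith [hmono_in δ, hmono_out δ, h1.1, h1.2, h2.1, h2.2, hdu.1, hdu.2, hdv.1, hdv.2]

end Summit.CriticalPhenomena.CardyFormulaZ2.Cruxes.RectilinearCardy.ExcursionKernelCovariance

end
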